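import Mathlib.Analysis.InnerProductSpace.PiL2
import Mathlib.Analysis.InnerProductSpace.Calculus
import Mathlib.Analysis.Calculus.ContDiff.Basic
import Mathlib.LinearAlgebra.FiniteDimensional.Lemmas
import Summits.SmoothPoincare4.SmoothPoincare4.Theses.DottedCircleRasmussen

/-!
# Helper `helper_friendsCarrier_Vk_partA_coeff` (piece 4 of the registered stub
`helper_friendsCarrier_Vk_partA`, line `mk_friends`, skeleton v8) for crux `DcrGap`
(item stmt-SmoothPoincare4-16128, route route-SmoothPoincare4-DottedCircleRasmussen)

**Smooth coefficients of a vector field along an immersed disc in the frame `(df e₀, df e₁, m₀, m₁)`.**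
Part A of V_k (the framing theorem) compares the prescribed boundary frame `bᵢ(u) = ∂_{wᵢ}|₀ νK(u, ·)` of
the model slice disc `f₁` with a trivialisation `(m₀, m₁)` of its normal bundle: `bᵢ = df₁ vᵢ + ∑ⱼ Aⱼᵢ mⱼ`.
This file produces the coefficients as `C^∞` functions: on an open set where the normal fields `m₀, m₁`
are orthogonal to the tangent planes and `(df, m₀, m₁)` is transversal, a `C^∞` field `b` decomposes as
`b = df(v) + α₀ m₀ + α₁ m₁` with `v, α₀, α₁` of class `C^∞` — Cramer's rule for the two `2 × 2` Gram
systems (tangential and normal), decoupled by orthogonality; the Gram determinants are non-zero by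
transversality, and the explicit solution IS the decomposition because `(v, a) ↦ df(v) + ∑ aⱼ mⱼ` is a
bijection of `ℝ⁴` (injective by transversality, equal dimensions).

* `FriendsCarrierVk.gram_ne_zero` — the Gram determinant of an independent pair is non-zero;
* `FriendsCarrierVk.decomp_of_transversal` — the pointwise linear algebra (Cramer);
* `FriendsCarrierVk.exists_smooth_coeff` / `helper_friendsCarrier_Vk_partA_coeff` — the statement.

No definitions, no named facts, no `sorry`.

## References

* M. W. Hirsch, *Differential Topology*, GTM 33 (1976), Ch. 4 §2 (normal bundles, Cor. 2.5). [Hirsch1976]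
-/

-- the prescribed namespace `Summit.<P>.<Sub>.…` duplicates `SmoothPoincare4` (P = Sub)
set_option linter.dupNamespace false
set_option linter.style.longLine false

noncomputable section

open scoped ContDiff Topology RealInnerProductSpace
open Set Function Metric Filter

namespace Summit.SmoothPoincare4.SmoothPoincare4.Theorems.DcrGap.MkFriends

namespace FriendsCarrierVk

/-! ## Pointwise: Cramer's rule gives the decomposition -/

/-- **The Gram determinant of an independent pair is non-zero.** [folklore] -/
theorem gram_ne_zero {p q : EuclideanSpace ℝ (Fin 4)} (hli : ∀ a₀ a₁ : ℝ, a₀ • p + a₁ • q = 0 → a₀ = 0 ∧ a₁ = 0) :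
    ⟪p, p⟫ * ⟪q, q⟫ - ⟪p, q⟫ * ⟪p, q⟫ ≠ 0 := by
  intro hdet
  -- `w = ⟪q,q⟫ p - ⟪p,q⟫ q` has `⟪w,w⟫ = ⟪q,q⟫ · det = 0`
  set w : EuclideanSpace ℝ (Fin 4) := ⟪q, q⟫ • p - ⟪p, q⟫ • q with hw
  have hww : ⟪w, w⟫ = ⟪q, q⟫ * (⟪p, p⟫ * ⟪q, q⟫ - ⟪p, q⟫ * ⟪p, q⟫) := by
    simp only [hw, inner_sub_left, inner_sub_right, inner_smul_left, inner_smul_right, RCLike.conj_to_real,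
      real_inner_comm q p]
    ring
  rw [hdet, mul_zero] at hww
  have hw0 : w = 0 := inner_self_eq_zero.1 hww
  have h1 := hli ⟪q, q⟫ (-⟪p, q⟫) (by rw [neg_smul, ← sub_eq_add_neg]; exact hw0)
  have hq : q = 0 := inner_self_eq_zero.1 h1.1
  have h2 := hli 0 1 (by rw [hq]; simp)
  exact one_ne_zero h2.2

/-- **Cramer's rule in the frame `(L e₀, L e₁, m₀, m₁)`.** For a transversal frame (`L v + a₀ m₀ + a₁ m₁ = 0`
only trivially) whose second pair is orthogonal to `range L`, every `b` equals `L v + α₀ m₀ + α₁ m₁` with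
the explicit Gram–Cramer coefficients. [folklore] -/
theorem decomp_of_transversal (L : EuclideanSpace ℝ (Fin 2) →L[ℝ] EuclideanSpace ℝ (Fin 4))
    (m₀ m₁ b : EuclideanSpace ℝ (Fin 4))
    (htr : ∀ (v : EuclideanSpace ℝ (Fin 2)) (a₀ a₁ : ℝ), L v + a₀ • m₀ + a₁ • m₁ = 0 → v = 0 ∧ a₀ = 0 ∧ a₁ = 0)
    (h0 : ∀ a, ⟪L a, m₀⟫ = 0) (h1 : ∀ a, ⟪L a, m₁⟫ = 0) :
    b = L (((⟪L (EuclideanSpace.single 1 1), L (EuclideanSpace.single 1 1)⟫ * ⟪L (EuclideanSpace.single 0 1), b⟫ -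
            ⟪L (EuclideanSpace.single 0 1), L (EuclideanSpace.single 1 1)⟫ * ⟪L (EuclideanSpace.single 1 1), b⟫) /
          (⟪L (EuclideanSpace.single 0 1), L (EuclideanSpace.single 0 1)⟫ * ⟪L (EuclideanSpace.single 1 1), L (EuclideanSpace.single 1 1)⟫ -
            ⟪L (EuclideanSpace.single 0 1), L (EuclideanSpace.single 1 1)⟫ * ⟪L (EuclideanSpace.single 0 1), L (EuclideanSpace.single 1 1)⟫)) •
            EuclideanSpace.single 0 1 +
        ((⟪L (EuclideanSpace.single 0 1), L (EuclideanSpace.single 0 1)⟫ * ⟪L (EuclideanSpace.single 1 1), b⟫ -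
            ⟪L (EuclideanSpace.single 0 1), L (EuclideanSpace.single 1 1)⟫ * ⟪L (EuclideanSpace.single 0 1), b⟫) /
          (⟪L (EuclideanSpace.single 0 1), L (EuclideanSpace.single 0 1)⟫ * ⟪L (EuclideanSpace.single 1 1), L (EuclideanSpace.single 1 1)⟫ -
            ⟪L (EuclideanSpace.single 0 1), L (EuclideanSpace.single 1 1)⟫ * ⟪L (EuclideanSpace.single 0 1), L (EuclideanSpace.single 1 1)⟫)) •
            EuclideanSpace.single 1 1) +
      ((⟪m₁, m₁⟫ * ⟪m₀, b⟫ - ⟪m₀, m₁⟫ * ⟪m₁, b⟫) / (⟪m₀, m₀⟫ * ⟪m₁, m₁⟫ - ⟪m₀, m₁⟫ * ⟪m₀, m₁⟫)) • m₀ +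
      ((⟪m₀, m₀⟫ * ⟪m₁, b⟫ - ⟪m₀, m₁⟫ * ⟪m₀, b⟫) / (⟪m₀, m₀⟫ * ⟪m₁, m₁⟫ - ⟪m₀, m₁⟫ * ⟪m₀, m₁⟫)) • m₁ := by
  -- abbreviations
  set t₀ : EuclideanSpace ℝ (Fin 4) := L (EuclideanSpace.single 0 1) with ht₀
  set t₁ : EuclideanSpace ℝ (Fin 4) := L (EuclideanSpace.single 1 1) with ht₁
  -- the Gram determinants
  have hDm : ⟪m₀, m₀⟫ * ⟪m₁, m₁⟫ - ⟪m₀, m₁⟫ * ⟪m₀, m₁⟫ ≠ 0 :=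
    gram_ne_zero fun a₀ a₁ h => by
      have := htr 0 a₀ a₁ (by rw [map_zero, zero_add]; exact h)
      exact ⟨this.2.1, this.2.2⟩
  have hDt : ⟪t₀, t₀⟫ * ⟪t₁, t₁⟫ - ⟪t₀, t₁⟫ * ⟪t₀, t₁⟫ ≠ 0 :=
    gram_ne_zero fun a₀ a₁ h => by
      rw [ht₀, ht₁, ← map_smul, ← map_smul, ← map_add] at h
      have h2 := htr (a₀ • EuclideanSpace.single 0 1 + a₁ • EuclideanSpace.single 1 1) 0 0 (by rw [h]; simp)
      have e0 := congrArg (fun z : EuclideanSpace ℝ (Fin 2) => z 0) h2.1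
      have e1 := congrArg (fun z : EuclideanSpace ℝ (Fin 2) => z 1) h2.1
      simp at e0 e1
      exact ⟨e0, e1⟩
  -- the frame map is a bijection: `b = L v' + a₀' m₀ + a₁' m₁` for some coefficients
  set Φ : (EuclideanSpace ℝ (Fin 2) × (ℝ × ℝ)) →ₗ[ℝ] EuclideanSpace ℝ (Fin 4) :=
    { toFun := fun q => L q.1 + q.2.1 • m₀ + q.2.2 • m₁
      map_add' := fun q q' => by
        simp only [Prod.fst_add, Prod.snd_add, map_add, add_smul]; abel
      map_smul' := fun c q => by
        simp only [Prod.smul_fst, Prod.smul_snd, smul_eq_mul, map_smul, RingHom.id_apply, smul_add, mul_smul] } with hΦ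
  have hΦinj : Injective Φ := by
    refine (injective_iff_map_eq_zero Φ).2 ?_
    rintro ⟨v, a₀, a₁⟩ h
    obtain ⟨hv, ha₀, ha₁⟩ := htr v a₀ a₁ h
    simp [hv, ha₀, ha₁]
  have hfin : Module.finrank ℝ (EuclideanSpace ℝ (Fin 2) × (ℝ × ℝ)) = Module.finrank ℝ (EuclideanSpace ℝ (Fin 4)) := by
    simp
  have hΦsurj : Surjective Φ := (LinearMap.injective_iff_surjective_of_finrank_eq_finrank hfin).1 hΦinj
  obtain ⟨⟨v', a₀', a₁'⟩, hb⟩ := hΦsurj b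
  have hb' : b = L v' + a₀' • m₀ + a₁' • m₁ := hb.symm
  -- inner products with the frame
  have hv' : v' = v' 0 • EuclideanSpace.single 0 (1 : ℝ) + v' 1 • EuclideanSpace.single 1 (1 : ℝ) := by
    ext i; fin_cases i <;> simp
  have hLv' : L v' = v' 0 • t₀ + v' 1 • t₁ := by
    conv_lhs => rw [hv']
    rw [map_add, map_smul, map_smul]
  have hm0b : ⟪m₀, b⟫ = a₀' * ⟪m₀, m₀⟫ + a₁' * ⟪m₀, m₁⟫ := by
    rw [hb', inner_add_right, inner_add_right, inner_smul_right, inner_smul_right, real_inner_comm (L v') m₀, h0,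
      zero_add]
  have hm1b : ⟪m₁, b⟫ = a₀' * ⟪m₀, m₁⟫ + a₁' * ⟪m₁, m₁⟫ := by
    rw [hb', inner_add_right, inner_add_right, inner_smul_right, inner_smul_right, real_inner_comm (L v') m₁, h1,
      zero_add, real_inner_comm m₀ m₁]
  have ht0b : ⟪t₀, b⟫ = v' 0 * ⟪t₀, t₀⟫ + v' 1 * ⟪t₀, t₁⟫ := by
    rw [hb', inner_add_right, inner_add_right, inner_smul_right, inner_smul_right, ht₀, h0, h1, hLv',
      inner_add_right, inner_smul_right, inner_smul_right]
    ring
  have ht1b : ⟪t₁, b⟫ = v' 0 * ⟪t₀, t₁⟫ + v' 1 * ⟪t₁, t₁⟫ := by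
    rw [hb', inner_add_right, inner_add_right, inner_smul_right, inner_smul_right, ht₁, h0, h1, hLv',
      inner_add_right, inner_smul_right, inner_smul_right, real_inner_comm t₀ (L (EuclideanSpace.single 1 1))]
    ring
  -- Cramer recovers the coefficients
  have eα₀ : (⟪m₁, m₁⟫ * ⟪m₀, b⟫ - ⟪m₀, m₁⟫ * ⟪m₁, b⟫) / (⟪m₀, m₀⟫ * ⟪m₁, m₁⟫ - ⟪m₀, m₁⟫ * ⟪m₀, m₁⟫) = a₀' := by
    rw [div_eq_iff hDm, hm0b, hm1b]; ring
  have eα₁ : (⟪m₀, m₀⟫ * ⟪m₁, b⟫ - ⟪m₀, m₁⟫ * ⟪m₀, b⟫) / (⟪m₀, m₀⟫ * ⟪m₁, m₁⟫ - ⟪m₀, m₁⟫ * ⟪m₀, m₁⟫) = a₁' := by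
    rw [div_eq_iff hDm, hm0b, hm1b]; ring
  have ev₀ : (⟪t₁, t₁⟫ * ⟪t₀, b⟫ - ⟪t₀, t₁⟫ * ⟪t₁, b⟫) / (⟪t₀, t₀⟫ * ⟪t₁, t₁⟫ - ⟪t₀, t₁⟫ * ⟪t₀, t₁⟫) = v' 0 := by
    rw [div_eq_iff hDt, ht0b, ht1b]; ring
  have ev₁ : (⟪t₀, t₀⟫ * ⟪t₁, b⟫ - ⟪t₀, t₁⟫ * ⟪t₀, b⟫) / (⟪t₀, t₀⟫ * ⟪t₁, t₁⟫ - ⟪t₀, t₁⟫ * ⟪t₀, t₁⟫) = v' 1 := by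
    rw [div_eq_iff hDt, ht0b, ht1b]; ring
  rw [eα₀, eα₁, ev₀, ev₁, ← hv']
  exact hb'

/-! ## Smoothness of the coefficients -/

variable {f : EuclideanSpace ℝ (Fin 2) → EuclideanSpace ℝ (Fin 4)} {m₀ m₁ b : EuclideanSpace ℝ (Fin 2) → EuclideanSpace ℝ (Fin 4)}
  {U : Set (EuclideanSpace ℝ (Fin 2))}

/-- **Smooth coefficients in a transversal orthogonal frame.**  On an open set `U` where `m₀, m₁, b` are
`C^∞`, the pair `(mⱼ)` is orthogonal to the tangent planes of the `C^∞` map `f` and `(df, m₀, m₁)` is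
transversal, there are `C^∞` (on `U`) coefficient functions with `b = df(v) + α₀ m₀ + α₁ m₁` (the set `U`
need not be open: smoothness is pointwise).
[cite: Hirsch1976, Ch. 4 §2 Cor. 2.5] -/
theorem exists_smooth_coeff (hf : ContDiff ℝ ∞ f)
    (hm₀ : ∀ x ∈ U, ContDiffAt ℝ ∞ m₀ x) (hm₁ : ∀ x ∈ U, ContDiffAt ℝ ∞ m₁ x) (hb : ∀ x ∈ U, ContDiffAt ℝ ∞ b x)
    (htr : ∀ x ∈ U, ∀ (v : EuclideanSpace ℝ (Fin 2)) (a₀ a₁ : ℝ), fderiv ℝ f x v + a₀ • m₀ x + a₁ • m₁ x = 0 → v = 0 ∧ a₀ = 0 ∧ a₁ = 0)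
    (h0 : ∀ x ∈ U, ∀ a, ⟪fderiv ℝ f x a, m₀ x⟫ = 0) (h1 : ∀ x ∈ U, ∀ a, ⟪fderiv ℝ f x a, m₁ x⟫ = 0) :
    ∃ (v : EuclideanSpace ℝ (Fin 2) → EuclideanSpace ℝ (Fin 2)) (α₀ α₁ : EuclideanSpace ℝ (Fin 2) → ℝ),
      (∀ x ∈ U, ContDiffAt ℝ ∞ v x ∧ ContDiffAt ℝ ∞ α₀ x ∧ ContDiffAt ℝ ∞ α₁ x) ∧
      ∀ x ∈ U, b x = fderiv ℝ f x (v x) + α₀ x • m₀ x + α₁ x • m₁ x := by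
  -- smooth ingredients
  have ht : ∀ i : Fin 2, ContDiff ℝ ∞ fun x => fderiv ℝ f x (EuclideanSpace.single i 1) := fun i =>
    (hf.fderiv_right (m := ∞) (by simp)).clm_apply contDiff_const
  set t₀ : EuclideanSpace ℝ (Fin 2) → EuclideanSpace ℝ (Fin 4) := fun x => fderiv ℝ f x (EuclideanSpace.single 0 1) with ht₀
  set t₁ : EuclideanSpace ℝ (Fin 2) → EuclideanSpace ℝ (Fin 4) := fun x => fderiv ℝ f x (EuclideanSpace.single 1 1) with ht₁
  have ht₀s : ContDiff ℝ ∞ t₀ := ht 0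
  have ht₁s : ContDiff ℝ ∞ t₁ := ht 1
  set Dt : EuclideanSpace ℝ (Fin 2) → ℝ := fun x => ⟪t₀ x, t₀ x⟫ * ⟪t₁ x, t₁ x⟫ - ⟪t₀ x, t₁ x⟫ * ⟪t₀ x, t₁ x⟫ with hDt
  set Dm : EuclideanSpace ℝ (Fin 2) → ℝ := fun x => ⟪m₀ x, m₀ x⟫ * ⟪m₁ x, m₁ x⟫ - ⟪m₀ x, m₁ x⟫ * ⟪m₀ x, m₁ x⟫ with hDm
  set v₀ : EuclideanSpace ℝ (Fin 2) → ℝ := fun x => (⟪t₁ x, t₁ x⟫ * ⟪t₀ x, b x⟫ - ⟪t₀ x, t₁ x⟫ * ⟪t₁ x, b x⟫) / Dt x with hv₀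
  set v₁ : EuclideanSpace ℝ (Fin 2) → ℝ := fun x => (⟪t₀ x, t₀ x⟫ * ⟪t₁ x, b x⟫ - ⟪t₀ x, t₁ x⟫ * ⟪t₀ x, b x⟫) / Dt x with hv₁
  set α₀ : EuclideanSpace ℝ (Fin 2) → ℝ := fun x => (⟪m₁ x, m₁ x⟫ * ⟪m₀ x, b x⟫ - ⟪m₀ x, m₁ x⟫ * ⟪m₁ x, b x⟫) / Dm x with hα₀
  set α₁ : EuclideanSpace ℝ (Fin 2) → ℝ := fun x => (⟪m₀ x, m₀ x⟫ * ⟪m₁ x, b x⟫ - ⟪m₀ x, m₁ x⟫ * ⟪m₀ x, b x⟫) / Dm x with hα₁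
  refine ⟨fun x => v₀ x • EuclideanSpace.single 0 1 + v₁ x • EuclideanSpace.single 1 1, α₀, α₁, fun x hx => ?_, fun x hx => ?_⟩
  · have hDtx : Dt x ≠ 0 := by
      have h := gram_ne_zero (p := t₀ x) (q := t₁ x) fun a₀ a₁ h => by
        simp only [ht₀, ht₁] at h
        rw [← map_smul, ← map_smul, ← map_add] at h
        have h2 := htr x hx (a₀ • EuclideanSpace.single 0 1 + a₁ • EuclideanSpace.single 1 1) 0 0 (by rw [h]; simp)
        have e0 := congrArg (fun z : EuclideanSpace ℝ (Fin 2) => z 0) h2.1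
        have e1 := congrArg (fun z : EuclideanSpace ℝ (Fin 2) => z 1) h2.1
        simp at e0 e1
        exact ⟨e0, e1⟩
      exact h
    have hDmx : Dm x ≠ 0 := by
      have h := gram_ne_zero (p := m₀ x) (q := m₁ x) fun a₀ a₁ h => by
        have := htr x hx 0 a₀ a₁ (by rw [map_zero, zero_add]; exact h)
        exact ⟨this.2.1, this.2.2⟩
      exact h
    have hm₀x := hm₀ x hx
    have hm₁x := hm₁ x hx
    have hbx := hb x hx
    have ht₀x : ContDiffAt ℝ ∞ t₀ x := ht₀s.contDiffAt
    have ht₁x : ContDiffAt ℝ ∞ t₁ x := ht₁s.contDiffAt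
    have hDts : ContDiffAt ℝ ∞ Dt x := ((ht₀x.inner ℝ ht₀x).mul (ht₁x.inner ℝ ht₁x)).sub ((ht₀x.inner ℝ ht₁x).mul (ht₀x.inner ℝ ht₁x))
    have hDms : ContDiffAt ℝ ∞ Dm x := ((hm₀x.inner ℝ hm₀x).mul (hm₁x.inner ℝ hm₁x)).sub ((hm₀x.inner ℝ hm₁x).mul (hm₀x.inner ℝ hm₁x))
    have hv₀s : ContDiffAt ℝ ∞ v₀ x :=
      ((((ht₁x.inner ℝ ht₁x).mul (ht₀x.inner ℝ hbx)).sub ((ht₀x.inner ℝ ht₁x).mul (ht₁x.inner ℝ hbx))).div hDts hDtx)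
    have hv₁s : ContDiffAt ℝ ∞ v₁ x :=
      ((((ht₀x.inner ℝ ht₀x).mul (ht₁x.inner ℝ hbx)).sub ((ht₀x.inner ℝ ht₁x).mul (ht₀x.inner ℝ hbx))).div hDts hDtx)
    have hα₀s : ContDiffAt ℝ ∞ α₀ x :=
      ((((hm₁x.inner ℝ hm₁x).mul (hm₀x.inner ℝ hbx)).sub ((hm₀x.inner ℝ hm₁x).mul (hm₁x.inner ℝ hbx))).div hDms hDmx)
    have hα₁s : ContDiffAt ℝ ∞ α₁ x :=
      ((((hm₀x.inner ℝ hm₀x).mul (hm₁x.inner ℝ hbx)).sub ((hm₀x.inner ℝ hm₁x).mul (hm₀x.inner ℝ hbx))).div hDms hDmx)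
    exact ⟨(hv₀s.smul contDiffAt_const).add (hv₁s.smul contDiffAt_const), hα₀s, hα₁s⟩
  · exact decomp_of_transversal (fderiv ℝ f x) (m₀ x) (m₁ x) (b x) (htr x hx) (h0 x hx) (h1 x hx)

end FriendsCarrierVk

open FriendsCarrierVk in
/-- **Helper `helper_friendsCarrier_Vk_partA_coeff`** (piece of `helper_friendsCarrier_Vk_partA`: smooth
coefficients in a transversal orthogonal frame).  Let `f : ℝ² → ℝ⁴` be `C^∞`, `U ⊆ ℝ²` open, and
`m₀, m₁, b : ℝ² → ℝ⁴` be `C^∞` at the points of `U`, with `mⱼ(x) ⊥ range df(x)` and `(df(x), m₀ x, m₁ x)`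
transversal for `x ∈ U`.  Then `b = df(v) + α₀ m₀ + α₁ m₁` on `U` for coefficient functions `v, α₀, α₁`
which are `C^∞` at the points of `U`. [cite: Hirsch1976, Ch. 4 §2 Cor. 2.5] -/
theorem helper_friendsCarrier_Vk_partA_coeff : ∀ (f : EuclideanSpace ℝ (Fin 2) → EuclideanSpace ℝ (Fin 4)) (m₀ m₁ b : EuclideanSpace ℝ (Fin 2) → EuclideanSpace ℝ (Fin 4)) (U : Set (EuclideanSpace ℝ (Fin 2))), ContDiff ℝ ((⊤ : ℕ∞) : WithTop ℕ∞) f → IsOpen U → (∀ x ∈ U, ContDiffAt ℝ ((⊤ : ℕ∞) : WithTop ℕ∞) m₀ x) → (∀ x ∈ U, ContDiffAt ℝ ((⊤ : ℕ∞) : WithTop ℕ∞) m₁ x) → (∀ x ∈ U, ContDiffAt ℝ ((⊤ : ℕ∞) : WithTop ℕ∞) b x) → (∀ x ∈ U, ∀ (v : EuclideanSpace ℝ (Fin 2)) (a₀ a₁ : ℝ), fderiv ℝ f x v + a₀ • m₀ x + a₁ • m₁ x = 0 → v = 0 ∧ a₀ = 0 ∧ a₁ = 0) → (∀ x ∈ U,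 ∀ a, inner ℝ (fderiv ℝ f x a) (m₀ x) = 0) → (∀ x ∈ U, ∀ a, inner ℝ (fderiv ℝ f x a) (m₁ x) = 0) → ∃ (v : EuclideanSpace ℝ (Fin 2) → EuclideanSpace ℝ (Fin 2)) (α₀ α₁ : EuclideanSpace ℝ (Fin 2) → ℝ), (∀ x ∈ U, ContDiffAt ℝ ((⊤ : ℕ∞) : WithTop ℕ∞) v x ∧ ContDiffAt ℝ ((⊤ : ℕ∞) : WithTop ℕ∞) α₀ x ∧ ContDiffAt ℝ ((⊤ : ℕ∞) : WithTop ℕ∞) α₁ x) ∧ ∀ x ∈ U, b x = fderiv ℝ f x (v x) + α₀ x • m₀ x + α₁ x • m₁ x := by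
  intro f m₀ m₁ b U hf _ hm₀ hm₁ hb htr h0 h1
  exact exists_smooth_coeff hf hm₀ hm₁ hb htr h0 h1

end Summit.SmoothPoincare4.SmoothPoincare4.Theorems.DcrGap.MkFriends

end
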